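import Literature.Topology.FourManifolds.SlideReshapeUpperIsotopy
import Literature.Topology.FourManifolds.SlideReshapeLower2
import HarnessLib

/-!
# Reshaping the upper arch: tracks that may linger on the left edge

Topic `Literature/Topology/FourManifolds`; fact seat `provefact-IsStrictHandleSlide.isSurgery`
(R. C. Kirby, *The Topology of 4-Manifolds*, LNM 1374 (1989), Ch. I §4; remaining content: the
named fact (S) `Literature.Topology.FourManifolds.FramedLink.IsStrictHandleSlide.slideModel`).
Upper mirror of `SlideReshapeLower2.lean`: variant of `planarFamily_upperTrack` /
`exists_ambientIsotopy_upperTrack` with `hX₁pos` replaced by "`X₁ s = 0` on `S` implies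
`H₁ s = fUp s`". Proved here (no definitions, no named facts):

* `BandCore.false_of_typeA_up'`, `BandCore.planarFamily_upperTrack'`,
  `BandCore.exists_ambientIsotopy_upperTrack'`.

## References

* R. C. Kirby, *The Topology of 4-Manifolds*, LNM 1374, Springer (1989), Ch. I §4. [Kirby1989]
* M. W. Hirsch, *Differential Topology* (1976), Ch. 8 §1, Thm. 1.3. [HirschDT1976]
-/

open scoped Manifold ContDiff Topology Real
open Function Set Metric

noncomputable section

namespace Literature.Topology.FourManifolds

namespace BandCore

variable {A B : Knot} {avoid : Set (Metric.sphere (0 : EuclideanSpace ℝ (Fin 4)) 1)} (c : BandCore A B avoid)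

/-- Disjointness (upper), type A parameters, for track points on the left edge at height `fUp s`.
[folklore] -/
theorem false_of_typeA_up' {x : EuclideanSpace ℝ (Fin 2)} (hxsq : x ∈ squareNhd c.δ)
    {s t : ℝ} (hs : s ∈ Icc (c.thi + c.epsHi / 4) (c.ahi - c.epsHi / 2)) (ht : t ∈ Ico c.alo (c.alo + 1))
    (hts : t ∉ Icc (c.thi + c.epsHi / 4) (c.ahi - c.epsHi / 2))
    (hA : t ≤ c.alo + c.epsLo ∨ c.ahi - c.epsHi ≤ t)
    (hleft : x 0 = 0 → x 1 = c.fUp s)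
    (he : ((c.band x : Metric.sphere (0 : EuclideanSpace ℝ (Fin 4)) 1) : EuclideanSpace ℝ (Fin 4)) = c.pieceFun t) : False := by
  have hm := c.marks_lt
  have hε := c.epsHi_bounds.1
  rw [c.pieceFun_typeA ht hA, Knot.curve_apply] at he
  have hmem : c.band x ∈ range ⇑A := ⟨circlePt t, (Subtype.ext he).symm⟩
  have hx00 : x 0 = 0 := by
    by_contra h; exact c.band_not_mem_range_A hxsq h hmem
  have hx1 := hleft hx00
  have hxeq : x = pt2 0 (c.fUp s) := by
    ext i; fin_cases i
    · exact hx00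
    · exact hx1
  have hsI : s ∈ Icc c.thi (c.thetaA (17 / 20)) := ⟨by linarith [hs.1], by linarith [hs.2, hm.2.2.2.2.2.1]⟩
  have hsI' : s ∈ Icc (c.thetaA 10⁻¹) (c.thetaA (9 / 10)) :=
    ⟨by linarith [hs.1, hm.1, hm.2.1, hm.2.2.1, hm.2.2.2.1], by linarith [hs.2, hm.2.2.2.2.2.1, hm.2.2.2.2.2.2.1]⟩
  rw [hxeq, (c.fUp_eq_heightA hsI).1, c.band_pt2_zero_heightA hsI'] at he
  have hst : circlePt s = circlePt t := A.injective (Subtype.ext he)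
  obtain ⟨n, hn⟩ := circlePt_eq_circlePt_iff.1 hst
  have hn1 : (n : ℝ) < 1 := by linarith [ht.1, hs.2, hm.2.2.2.2.2.1, hm.2.2.2.2.2.2.1, hm.2.2.2.2.2.2.2, hm.2.2.1, hm.2.2.2.1]
  have hn2 : (-1 : ℝ) < n := by linarith [ht.2, hs.1, hm.2.2.1, hm.2.2.2.1]
  have hn1' : n < 1 := by exact_mod_cast hn1
  have hn2' : -1 < n := by exact_mod_cast hn2
  obtain rfl : n = 0 := by omega
  simp only [Int.cast_zero, add_zero] at hn
  exact hts (hn ▸ hs)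

/-- **The planar family reshaping the upper arch (tracks that may linger on the left edge).**
Variant of `planarFamily_upperTrack` with `hX₁pos` replaced by: wherever `X₁` vanishes on `S`,
the height is `fUp`. Parameters `a = alo`,
`ε_f = min (ε'/4) (alo + 1 - ahi)`, `S = [thi + ε'/4, ahi - ε'/2]`, inner `(thi + ε'/2, ahi - ε')`,
`ε' = epsHi`. [cite: HirschDT1976, Ch. 8 §1, Thm. 1.3] -/
theorem planarFamily_upperTrack' (hAB : Disjoint (range ⇑A) (range ⇑B)) {X₁ H₁ : ℝ → ℝ}
    (hX₁s : ContDiff ℝ ∞ X₁) (hH₁s : ContDiff ℝ ∞ H₁)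
    (hagreeX : ∀ t, t ∉ Ioo (c.thi + c.epsHi / 2) (c.ahi - c.epsHi) → X₁ t = c.cUp t 0)
    (hagreeH : ∀ t, t ∉ Ioo (c.thi + c.epsHi / 2) (c.ahi - c.epsHi) → H₁ t = c.cUp t 1)
    (hX₁I : ∀ t, X₁ t ∈ Icc (0 : ℝ) 1) (hdX₁ : ∀ t, deriv X₁ t ≤ 0)
    (hX₁zero : ∀ s ∈ Icc (c.thi + c.epsHi / 4) (c.ahi - c.epsHi / 2), X₁ s = 0 → H₁ s = c.fUp s)
    (hX₁lt : ∀ t, c.thi + 2 * c.epsHi < t → X₁ t < 1)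
    (hH₁I : ∀ t ∈ Icc (c.thi + c.epsHi / 4) (c.ahi - c.epsHi / 2), H₁ t ∈ Ioo (2⁻¹ : ℝ) (9 / 10))
    (hH₁le : ∀ t ∈ Icc (c.thi + c.epsHi / 4) (c.thi + 2 * c.epsHi), X₁ t = 1 → H₁ t ≤ c.gUp t)
    (hinj₁ : InjOn (fun t ↦ (pt2 (X₁ t) (H₁ t) : EuclideanSpace ℝ (Fin 2))) (Icc (c.thi + c.epsHi / 4) (c.ahi - c.epsHi / 2)))
    (hreg₁ : ∀ s ∈ Icc (c.thi + c.epsHi / 4) (c.ahi - c.epsHi / 2), deriv X₁ s = 0 → deriv H₁ s ≠ 0)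
    (hco : ∀ t ∈ Icc (c.thi + c.epsHi / 4) (c.ahi - c.epsHi / 2), ∀ t' ∈ Icc (c.thi + c.epsHi / 4) (c.ahi - c.epsHi / 2),
      t < t' → c.cUp t 0 = c.cUp t' 0 → X₁ t = X₁ t' →
      (c.cUp t 1 < c.cUp t' 1 ∧ H₁ t < H₁ t') ∨ (c.cUp t' 1 < c.cUp t 1 ∧ H₁ t' < H₁ t))
    (hcoD : ∀ s ∈ Icc (c.thi + c.epsHi / 4) (c.ahi - c.epsHi / 2),
      deriv (fun t ↦ c.cUp t 0) s = 0 → deriv X₁ s = 0 → 0 < deriv (fun t ↦ c.cUp t 1) s * deriv H₁ s) :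
    (c.rebuildData hAB).PlanarFamily (c.rebuild hAB) c.alo (min (c.epsHi / 4) (c.alo + 1 - c.ahi))
      (c.thi + c.epsHi / 4) (c.thi + c.epsHi / 2) (c.ahi - c.epsHi) (c.ahi - c.epsHi / 2)
      (fun u t ↦ pt2 ((1 - u) * c.cUp t 0 + u * X₁ t) ((1 - u) * c.cUp t 1 + u * H₁ t)) := by
  have hm := c.marks_lt
  obtain ⟨hε', hε'5, hε'lam⟩ := c.epsHi_bounds
  have hat : c.thi + 2 * c.epsHi < c.ahi - 2 * c.epsHi := c.thi_add_lt_ahi_sub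
  have hahi1 : c.ahi < c.alo + 1 := by linarith [hm.2.2.2.2.2.1, hm.2.2.2.2.2.2.1, hm.2.2.2.2.2.2.2]
  have hδ := c.δ_pos
  set ε := c.epsHi with hεdef
  have hX₀s : ContDiff ℝ ∞ (fun t ↦ c.cUp t 0) := (contDiff_euclidean.1 c.contDiff_cUp) 0
  have hH₀s : ContDiff ℝ ∞ (fun t ↦ c.cUp t 1) := (contDiff_euclidean.1 c.contDiff_cUp) 1
  have hpt : ∀ t, (pt2 (c.cUp t 0) (c.cUp t 1) : EuclideanSpace ℝ (Fin 2)) = c.cUp t := fun t ↦ by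
    ext i; fin_cases i <;> rfl
  refine BandData.planarFamily_convex_antitone (c.rebuildData hAB) (lt_min (by linarith) (by linarith))
    ⟨by linarith [min_le_left (c.epsHi / 4) (c.alo + 1 - c.ahi), hm.2.2.1, hm.2.2.2.1], by linarith, by linarith, by linarith,
      by linarith [min_le_right (c.epsHi / 4) (c.alo + 1 - c.ahi)]⟩
    hX₀s hX₁s hH₀s hH₁s hagreeX hagreeH (fun s hs ↦ ?_) (fun s hs ↦ ?_) (fun s hs ↦ ?_)
    (fun s _ ↦ c.deriv_cUp_fst_nonpos s) (fun s _ ↦ hdX₁ s) (fun t ht t' ht' he ↦ ?_) hinj₁ hco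
    (fun s _ h0 ↦ ?_) hreg₁ hcoD (fun u hu s hs t ht hts ↦ ?_)
  · rw [hpt, rebuildData_band]
    exact c.curve_rebuild_eq_band_cUp hAB ⟨by linarith [hs.1], by linarith [hs.2]⟩
  · rw [hpt, rebuildData_δ]
    exact (c.cUp_mem ⟨by linarith [hs.1], by linarith [hs.2]⟩).1
  · rw [rebuildData_δ]
    intro i; fin_cases i
    · show X₁ s ∈ Ioo (-c.δ) (1 + c.δ); exact ⟨by linarith [(hX₁I s).1], by linarith [(hX₁I s).2]⟩
    · show H₁ s ∈ Ioo (-c.δ) (1 + c.δ)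
      have h := hH₁I s hs
      exact ⟨by linarith [h.1], by linarith [h.2]⟩
  · have he' : c.cUp t = c.cUp t' := by simpa only [hpt] using he
    exact c.injective_cUp he'
  · intro h1
    apply c.deriv_cUp_ne_zero s
    have hX₀d : HasDerivAt (fun t ↦ c.cUp t 0) (deriv (fun t ↦ c.cUp t 0) s) s := ((hX₀s.differentiable (by simp)) s).hasDerivAt
    have hH₀d : HasDerivAt (fun t ↦ c.cUp t 1) (deriv (fun t ↦ c.cUp t 1) s) s := ((hH₀s.differentiable (by simp)) s).hasDerivAt
    have hc := hasDerivAt_pt2 hX₀d hH₀d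
    have hfun : (fun t ↦ (pt2 (c.cUp t 0) (c.cUp t 1) : EuclideanSpace ℝ (Fin 2))) = c.cUp := funext hpt
    rw [hfun] at hc
    rw [hc.deriv, h0, h1]
    ext i; fin_cases i <;> rfl
  · -- disjointness
    intro he
    set x : EuclideanSpace ℝ (Fin 2) := pt2 ((1 - u) * c.cUp s 0 + u * X₁ s) ((1 - u) * c.cUp s 1 + u * H₁ s) with hx
    have hsI : s ∈ Icc c.thi c.ahi := ⟨by linarith [hs.1], by linarith [hs.2]⟩
    have hx0 : x 0 = (1 - u) * c.cUp s 0 + u * X₁ s := rfl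
    have hx1 : x 1 = (1 - u) * c.cUp s 1 + u * H₁ s := rfl
    have hc0 := c.cUp_fst_mem_Icc' s
    have hc1 : c.cUp s 1 ∈ Ioo (3 / 5 : ℝ) (9 / 10) := (c.cUp_mem hsI).2
    have hX := hX₁I s
    have hH := hH₁I s hs
    have hx0I : x 0 ∈ Icc (0 : ℝ) 1 := by
      rw [hx0]
      have a1 := mul_nonneg hu.1 hX.1
      have a2 := mul_nonneg (sub_nonneg.2 hu.2) hc0.1
      have a3 := mul_nonneg (sub_nonneg.2 hu.2) (sub_nonneg.2 hc0.2)
      have a4 := mul_nonneg hu.1 (sub_nonneg.2 hX.2)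
      constructor <;> nlinarith
    have hx1I : x 1 ∈ Ioo (2⁻¹ : ℝ) (9 / 10) := by
      rw [hx1]; exact convex_mem_Ioo ⟨by linarith [hc1.1], hc1.2⟩ hH hu
    have hxsq : x ∈ squareNhd c.δ := by
      intro i; fin_cases i
      · show x 0 ∈ Ioo (-c.δ) (1 + c.δ); exact ⟨by linarith [hx0I.1], by linarith [hx0I.2]⟩
      · show x 1 ∈ Ioo (-c.δ) (1 + c.δ); exact ⟨by linarith [hx1I.1], by linarith [hx1I.2]⟩
    rw [rebuildData_band] at he
    rw [c.curve_rebuild_eq_pieceFun hAB ht] at he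
    rcases c.kind_cases t with hA | hB | hO | hO
    · refine c.false_of_typeA_up' hxsq hs ht hts hA (fun hx00 ↦ ?_) he
      rw [hx0] at hx00
      have ha : 0 ≤ (1 - u) * c.cUp s 0 := mul_nonneg (sub_nonneg.2 hu.2) hc0.1
      have hb : 0 ≤ u * X₁ s := mul_nonneg hu.1 hX.1
      have ha0 : (1 - u) * c.cUp s 0 = 0 := by linarith
      have hb0 : u * X₁ s = 0 := by linarith
      have hzero : c.cUp s 0 = 0 → c.ahi - ε ≤ s := fun h0 ↦ by
        by_contra hlt; push Not at hlt
        have h1 : 0 < c.cUp s 0 := by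
          rw [c.cUp_apply_zero']
          rcases le_or_gt s (c.thi + ε) with h | h
          · rw [smoothStep_of_ge (by linarith) (by linarith)]; exact one_pos
          · exact (smoothStep_mem_Ioo (by linarith) ⟨by linarith, by linarith⟩).1
        linarith
      rw [hx1]
      rcases hu.1.eq_or_lt with hu0 | hu0
      · rw [← hu0] at ha0 ⊢
        simp only [sub_zero, one_mul] at ha0
        rw [c.cUp_snd_eq_fUp_of_ge (by linarith [hzero ha0])]; ring
      rcases hu.2.eq_or_lt with hu1 | hu1
      · rw [hu1] at hb0 ⊢
        simp only [one_mul] at hb0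
        rw [hX₁zero s hs hb0]; ring
      · have h1 : c.cUp s 0 = 0 := by
          rcases mul_eq_zero.1 ha0 with h | h
          · exact absurd h (by linarith)
          · exact h
        have h2 : X₁ s = 0 := by
          rcases mul_eq_zero.1 hb0 with h | h
          · exact absurd h hu0.ne'
          · exact h
        rw [c.cUp_snd_eq_fUp_of_ge (by linarith [hzero h1]), hX₁zero s hs h2]; ring
    · refine c.false_of_typeB_up hxsq hx1I hs hts hB (fun hx01 ↦ ?_) he
      have hsle : s ≤ c.thi + 2 * ε := by
        by_contra hlt; push Not at hlt
        have h1 : c.cUp s 0 < 1 := by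
          rw [c.cUp_apply_zero']
          rcases lt_or_ge s (c.ahi - ε) with h | h
          · exact (smoothStep_mem_Ioo (by linarith) ⟨by linarith, by linarith⟩).2
          · rw [smoothStep_of_le (by linarith) (by linarith)]; norm_num
        have h2 : X₁ s < 1 := hX₁lt s hlt
        have : x 0 < 1 := by
          rw [hx0]
          rcases hu.1.eq_or_lt with hu0 | hu0
          · rw [← hu0]; linarith
          · have : 0 < u * (1 - X₁ s) := mul_pos hu0 (sub_pos.2 h2)
            have h' : 0 ≤ (1 - u) * (1 - c.cUp s 0) := mul_nonneg (sub_nonneg.2 hu.2) (sub_nonneg.2 h1.le)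
            nlinarith
        linarith
      refine ⟨hsle, ?_⟩
      have hv : c.cUp s 1 = c.gUp s := c.cUp_snd_eq_gUp_of_le hsle
      rcases hu.1.eq_or_lt with hu0 | hu0
      · rw [hx1, ← hu0, hv]; simp
      · have hX1 : X₁ s = 1 := by
          have h1 : c.cUp s 0 ≤ 1 := hc0.2
          have h2 : X₁ s ≤ 1 := hX.2
          rw [hx0] at hx01
          have ha : 0 ≤ (1 - u) * (1 - c.cUp s 0) := mul_nonneg (sub_nonneg.2 hu.2) (sub_nonneg.2 h1)
          have hb : 0 ≤ u * (1 - X₁ s) := mul_nonneg hu.1 (sub_nonneg.2 h2)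
          have hb0 : u * (1 - X₁ s) = 0 := by linarith
          rcases mul_eq_zero.1 hb0 with h | h
          · exact absurd h hu0.ne'
          · linarith
        have hH1 := hH₁le s ⟨hs.1, hsle⟩ hX1
        have hpos : 0 ≤ u * (c.gUp s - H₁ s) := mul_nonneg hu.1 (sub_nonneg.2 hH1)
        rw [hx1, hv]; linarith
    · exact c.false_of_typeO_lo_up hxsq hx1I.1 hO he
    · exact hts ⟨by linarith [hO.1], by linarith [hO.2]⟩

/-- **The reshaping isotopy of the upper arch** (variant for tracks lingering on the left edge). Under the hypotheses of
`planarFamily_upperTrack`, for every open `O ⊆ S³` containing all band images of the intermediate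
tracks there are an ambient isotopy `Θ` of `S³`, stationary off `O`, and a knot `k₂` with
`Θ 1 ∘ K♮ = k₂`, `k₂ (circlePt s) = band (X₁ s, H₁ s)` for `s ∈ S` and `k₂ (circlePt t) = K♮ (circlePt t)`
for `t ∈ [alo, alo + 1) ∖ S`. [cite: HirschDT1976, Ch. 8 §1, Thm. 1.3] -/
theorem exists_ambientIsotopy_upperTrack' (hAB : Disjoint (range ⇑A) (range ⇑B)) {X₁ H₁ : ℝ → ℝ}
    (hX₁s : ContDiff ℝ ∞ X₁) (hH₁s : ContDiff ℝ ∞ H₁)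
    (hagreeX : ∀ t, t ∉ Ioo (c.thi + c.epsHi / 2) (c.ahi - c.epsHi) → X₁ t = c.cUp t 0)
    (hagreeH : ∀ t, t ∉ Ioo (c.thi + c.epsHi / 2) (c.ahi - c.epsHi) → H₁ t = c.cUp t 1)
    (hX₁I : ∀ t, X₁ t ∈ Icc (0 : ℝ) 1) (hdX₁ : ∀ t, deriv X₁ t ≤ 0)
    (hX₁zero : ∀ s ∈ Icc (c.thi + c.epsHi / 4) (c.ahi - c.epsHi / 2), X₁ s = 0 → H₁ s = c.fUp s)
    (hX₁lt : ∀ t, c.thi + 2 * c.epsHi < t → X₁ t < 1)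
    (hH₁I : ∀ t ∈ Icc (c.thi + c.epsHi / 4) (c.ahi - c.epsHi / 2), H₁ t ∈ Ioo (2⁻¹ : ℝ) (9 / 10))
    (hH₁le : ∀ t ∈ Icc (c.thi + c.epsHi / 4) (c.thi + 2 * c.epsHi), X₁ t = 1 → H₁ t ≤ c.gUp t)
    (hinj₁ : InjOn (fun t ↦ (pt2 (X₁ t) (H₁ t) : EuclideanSpace ℝ (Fin 2))) (Icc (c.thi + c.epsHi / 4) (c.ahi - c.epsHi / 2)))
    (hreg₁ : ∀ s ∈ Icc (c.thi + c.epsHi / 4) (c.ahi - c.epsHi / 2), deriv X₁ s = 0 → deriv H₁ s ≠ 0)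
    (hco : ∀ t ∈ Icc (c.thi + c.epsHi / 4) (c.ahi - c.epsHi / 2), ∀ t' ∈ Icc (c.thi + c.epsHi / 4) (c.ahi - c.epsHi / 2),
      t < t' → c.cUp t 0 = c.cUp t' 0 → X₁ t = X₁ t' →
      (c.cUp t 1 < c.cUp t' 1 ∧ H₁ t < H₁ t') ∨ (c.cUp t' 1 < c.cUp t 1 ∧ H₁ t' < H₁ t))
    (hcoD : ∀ s ∈ Icc (c.thi + c.epsHi / 4) (c.ahi - c.epsHi / 2),
      deriv (fun t ↦ c.cUp t 0) s = 0 → deriv X₁ s = 0 → 0 < deriv (fun t ↦ c.cUp t 1) s * deriv H₁ s)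
    {O : Set (Metric.sphere (0 : EuclideanSpace ℝ (Fin 4)) 1)} (hO : IsOpen O)
    (hOsub : ∀ u ∈ Icc (0 : ℝ) 1, ∀ s ∈ Icc (c.thi + c.epsHi / 4) (c.ahi - c.epsHi / 2),
      c.band (pt2 ((1 - u) * c.cUp s 0 + u * X₁ s) ((1 - u) * c.cUp s 1 + u * H₁ s)) ∈ O) :
    ∃ (Θ : AmbientIsotopy (𝓡 3) (Metric.sphere (0 : EuclideanSpace ℝ (Fin 4)) 1)) (k₂ : Knot),
      (∀ t y, y ∉ O → Θ.toFun t y = y) ∧ Θ.toFun 1 ∘ ⇑(c.rebuild hAB) = ⇑k₂ ∧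
      (∀ s ∈ Icc (c.thi + c.epsHi / 4) (c.ahi - c.epsHi / 2), k₂ (circlePt s) = c.band (pt2 (X₁ s) (H₁ s))) ∧
      (∀ t ∈ Ico c.alo (c.alo + 1), t ∉ Icc (c.thi + c.epsHi / 4) (c.ahi - c.epsHi / 2) →
        k₂ (circlePt t) = c.rebuild hAB (circlePt t)) := by
  have hP := c.planarFamily_upperTrack' hAB hX₁s hH₁s hagreeX hagreeH hX₁I hdX₁ hX₁zero hX₁lt hH₁I hH₁le hinj₁ hreg₁ hco hcoD
  have hGO : ∀ y : Metric.sphere (0 : EuclideanSpace ℝ (Fin 4)) 1, y ∉ O → ∀ u ∈ Icc (0 : ℝ) 1,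
      ∀ s ∈ Icc (c.thi + c.epsHi / 4) (c.ahi - c.epsHi / 2), (y : EuclideanSpace ℝ (Fin 4)) ≠ hP.fam u s := by
    intro y hy u hu s hs he
    rw [hP.fam_of_mem u hs, rebuildData_band] at he
    have hmem := hOsub u hu s hs
    have : y = c.band (pt2 ((1 - u) * c.cUp s 0 + u * X₁ s) ((1 - u) * c.cUp s 1 + u * H₁ s)) := Subtype.ext he
    exact hy (this ▸ hmem)
  obtain ⟨Θ, hΘO, hΘ, -⟩ := hP.isModification.exists_ambientIsotopy hO hGO
  refine ⟨Θ, hP.outKnot, hΘO, hΘ 1 ⟨zero_le_one, le_rfl⟩, fun s hs ↦ ?_, fun t ht hts ↦ ?_⟩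
  · rw [hP.outKnot_circlePt_of_mem hs, rebuildData_band]
    simp
  · exact hP.outKnot_circlePt_of_not_mem ht hts

end BandCore

end Literature.Topology.FourManifolds
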